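import Mathlib
import Literature.Combinatorics.Additive.TripleProductProperty
import Summits.MatrixMultiplication.MatrixMultiplication.Theorems.HyperoctahedralThreshold.Negative.SubgroupPivotSieve

/-!
# `OneThinnedHostDesign` is false — the dead certificate of line `Sketch`, kernel-checked

Crux `SnSubsetDichotomy.HyperoctahedralThreshold` (stmt-MatrixMultiplication-10883), line lead
prover-line-stmt-MatrixMultiplication-10883-1, cycle 2.  The positive skeleton `Sketch`
(`Cruxes/HyperoctahedralThreshold/SketchIdeator2.lean`, ideator 2, card `one-thinned-host-cayley-code`) is a
sorry-free composition `OneThinnedHostDesign → HyperoctahedralThreshold`; its one obligation, the transfer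
statement `OneThinnedHostDesign` (reproduced VERBATIM in the type of `not_oneThinnedHostDesign` below — no new
`def` is introduced), asks for every `c > 0`, infinitely often, three fixed-point-free involutions `μ i`, two
roots `r₀ r₁`, and an independent set `X ⊆ C(μ 2)` of the Cayley graph generated by the rooted product set
`(C(μ 1) ∩ Stab r₁)·(C(μ 0) ∩ Stab r₀)` with `|A|·|B|·|X| > (n!)^{3/2}e^{-c√n}`, where
`A = C(μ 0) ∩ Stab r₀`, `B = C(μ 1) ∩ Stab r₁` are SUBGROUPS.  Independence makes `(A, B, X)` a TPP triple
(`OneThinnedHost.tpp_of_independent`, the ideator's own criterion), so the subgroup `A` is conceded WHOLE and the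
subgroup-pivot sieve of this directory (`conceded_subgroup_cap`, p86923: `|A||B||X| ≤ (n!)^{3/2}e^{-(c₂/2)√n}` for
`n ≥ n₀`, `c₂ = vkUpperConst = (π-2)/π²`) refutes the design at `c := c₂/4`.

Main statement: `not_oneThinnedHostDesign`.  Standard axioms only.
-/

set_option linter.dupNamespace false

namespace Summit.MatrixMultiplication.MatrixMultiplication.Theorems.HyperoctahedralThreshold.Negative

open Literature.Combinatorics.Additive
open Literature.RepresentationTheory.FiniteGroups
open scoped Pointwise

namespace OneThinnedHost

/-- ONE-THINNED-HOST CRITERION (ideator 2, `SketchIdeator2.lean: tpp_of_one_thinned_host`, reproduced):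
with two subgroups `A, B`, `A ⊓ B = ⊥`, and a subset `X` no two distinct elements of which differ on the
right by an element of `B·A`, the triple `(A, B, X)` has the triple product property. -/
theorem tpp_of_independent {G : Type*} [Group G] [DecidableEq G] [Fintype G] (A B : Subgroup G)
    [DecidablePred (· ∈ A)] [DecidablePred (· ∈ B)] (X : Finset G) (hAB : A ⊓ B = ⊥)
    (hX : ∀ x ∈ X, ∀ x' ∈ X, x * x'⁻¹ ∈ (B : Set G) * (A : Set G) → x = x') :
    TripleProductProperty (Finset.univ.filter (· ∈ A)) (Finset.univ.filter (· ∈ B)) X := by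
  intro s hs s' hs' t ht t' ht' u hu u' hu' he
  simp only [Finset.mem_filter, Finset.mem_univ, true_and] at hs hs' ht ht'
  have hq0 : s * s'⁻¹ ∈ A := A.mul_mem hs (A.inv_mem hs')
  have hq1 : t * t'⁻¹ ∈ B := B.mul_mem ht (B.inv_mem ht')
  have hu_eq : u * u'⁻¹ = (t * t'⁻¹)⁻¹ * (s * s'⁻¹)⁻¹ := by
    rw [eq_inv_of_mul_eq_one_right he, mul_inv_rev]
  have huu' : u = u' := hX u hu u' hu' (by
    rw [hu_eq]
    exact Set.mul_mem_mul (B.inv_mem hq1) (A.inv_mem hq0))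
  subst huu'
  have he' : s * s'⁻¹ * (t * t'⁻¹) = 1 := by simpa using he
  have hq0' : s * s'⁻¹ = (t * t'⁻¹)⁻¹ := eq_inv_of_mul_eq_one_left he'
  have hmem : s * s'⁻¹ ∈ A ⊓ B := by
    refine Subgroup.mem_inf.mpr ⟨hq0, ?_⟩
    rw [hq0']; exact B.inv_mem hq1
  rw [hAB, Subgroup.mem_bot] at hmem
  have ht1 : t * t'⁻¹ = 1 := by
    rw [hmem] at hq0'
    exact inv_eq_one.mp hq0'.symm
  exact ⟨mul_inv_eq_one.mp hmem, mul_inv_eq_one.mp ht1, rfl⟩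

/-- Membership in the rooted matching stabiliser `C(μ) ⊓ Stab r`, unfolded. -/
theorem mem_rooted_iff {n : ℕ} (μ : Equiv.Perm (Fin n)) (r : Fin n) (g : Equiv.Perm (Fin n)) :
    g ∈ Subgroup.centralizer {μ} ⊓ MulAction.stabilizer (Equiv.Perm (Fin n)) r ↔
      g * μ = μ * g ∧ g r = r := by
  simp only [Subgroup.mem_inf, Subgroup.mem_centralizer_iff, Set.mem_singleton_iff, forall_eq,
    MulAction.mem_stabilizer_iff, Equiv.Perm.smul_def]
  constructor
  · rintro ⟨h1, h2⟩; exact ⟨h1.symm, h2⟩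
  · rintro ⟨h1, h2⟩; exact ⟨h1.symm, h2⟩

end OneThinnedHost

/-- **Line `Sketch` is dead: `¬ OneThinnedHostDesign`.**  The transfer statement of the positive skeleton
`SketchIdeator2.lean` (reproduced verbatim as the negated proposition) is false: for `c := vkUpperConst / 4`
and `n₀ :=` the threshold of `conceded_subgroup_cap`, a design would be a TPP triple `(A, B, X)` with the
subgroup `A = C(μ 0) ∩ Stab r₀` conceded whole and `(n!)^{3/2}e^{-(c₂/4)√n} < |A||B||X| ≤ (n!)^{3/2}e^{-(c₂/2)√n}`,
impossible.  [this line's TRIAGE-r1-1 §0 T1 / §4; sieve p86923] -/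
theorem not_oneThinnedHostDesign :
    ¬ (∀ c : ℝ, 0 < c → ∀ n₀ : ℕ, ∃ n ≥ n₀, ∃ μ : Fin 3 → Equiv.Perm (Fin n),
      (∀ i, μ i * μ i = 1 ∧ ∀ x, μ i x ≠ x) ∧ ∃ r₀ r₁ : Fin n, ∃ X : Finset (Equiv.Perm (Fin n)),
        (∀ σ ∈ X, σ * μ 2 = μ 2 * σ) ∧
        (∀ g : Equiv.Perm (Fin n), g * μ 0 = μ 0 * g → g * μ 1 = μ 1 * g → g r₀ = r₀ → g r₁ = r₁ → g = 1) ∧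
        (∀ x ∈ X, ∀ x' ∈ X, (∃ b a : Equiv.Perm (Fin n), b * μ 1 = μ 1 * b ∧ b r₁ = r₁ ∧
            a * μ 0 = μ 0 * a ∧ a r₀ = r₀ ∧ x * x'⁻¹ = b * a) → x = x') ∧
        (n.factorial : ℝ) ^ ((3 : ℝ) / 2) * Real.exp (-(c * Real.sqrt (n : ℝ))) <
          (((Finset.univ.filter (fun g : Equiv.Perm (Fin n) => g * μ 0 = μ 0 * g ∧ g r₀ = r₀)).card *
            (Finset.univ.filter (fun g : Equiv.Perm (Fin n) => g * μ 1 = μ 1 * g ∧ g r₁ = r₁)).card *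
            X.card : ℕ) : ℝ)) := by
  intro h
  obtain ⟨n₁, hcap⟩ := conceded_subgroup_cap
  have hc2 : 0 < vkUpperConst := vkUpperConst_pos
  obtain ⟨n, hn, μ, _hμ, r₀, r₁, X, _hX2, htriv, hind, hbig⟩ := h (vkUpperConst / 4) (by linarith) n₁
  classical
  -- the two rooted hosts as subgroups
  set A : Subgroup (Equiv.Perm (Fin n)) :=
    Subgroup.centralizer {μ 0} ⊓ MulAction.stabilizer (Equiv.Perm (Fin n)) r₀ with hA_def
  set B : Subgroup (Equiv.Perm (Fin n)) :=
    Subgroup.centralizer {μ 1} ⊓ MulAction.stabilizer (Equiv.Perm (Fin n)) r₁ with hB_def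
  have hmemA : ∀ g, g ∈ A ↔ g * μ 0 = μ 0 * g ∧ g r₀ = r₀ := fun g => OneThinnedHost.mem_rooted_iff (μ 0) r₀ g
  have hmemB : ∀ g, g ∈ B ↔ g * μ 1 = μ 1 * g ∧ g r₁ = r₁ := fun g => OneThinnedHost.mem_rooted_iff (μ 1) r₁ g
  have hAB : A ⊓ B = ⊥ := by
    rw [Subgroup.eq_bot_iff_forall]
    intro g hg
    rw [Subgroup.mem_inf] at hg
    obtain ⟨hA, hB⟩ := hg
    rw [hmemA] at hA; rw [hmemB] at hB
    exact htriv g hA.1 hB.1 hA.2 hB.2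
  have hXind : ∀ x ∈ X, ∀ x' ∈ X, x * x'⁻¹ ∈ (B : Set (Equiv.Perm (Fin n))) * (A : Set _) → x = x' := by
    intro x hx x' hx' hmul
    obtain ⟨b, hb, a, ha, hba⟩ := Set.mem_mul.1 hmul
    have hb' := (hmemB b).1 hb
    have ha' := (hmemA a).1 ha
    exact hind x hx x' hx' ⟨b, a, hb'.1, hb'.2, ha'.1, ha'.2, hba.symm⟩
  have hTPP := OneThinnedHost.tpp_of_independent A B X hAB hXind
  set XA : Finset (Equiv.Perm (Fin n)) := Finset.univ.filter (· ∈ A) with hXA_def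
  set XB : Finset (Equiv.Perm (Fin n)) := Finset.univ.filter (· ∈ B) with hXB_def
  have hXA : XA = Finset.univ.filter (fun g : Equiv.Perm (Fin n) => g * μ 0 = μ 0 * g ∧ g r₀ = r₀) :=
    Finset.filter_congr (fun g _ => hmemA g)
  have hXB : XB = Finset.univ.filter (fun g : Equiv.Perm (Fin n) => g * μ 1 = μ 1 * g ∧ g r₁ = r₁) :=
    Finset.filter_congr (fun g _ => hmemB g)
  -- the sieve caps the conceded-subgroup triple
  have hcapn := hcap n hn A XA XB X (fun x => by simp [hXA_def]) hTPP
  rw [hXA, hXB] at hcapn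
  -- compare the two exponentials
  have hsq : 0 ≤ Real.sqrt (n : ℝ) := Real.sqrt_nonneg _
  have hexp : Real.exp (-(vkUpperConst / 2 * Real.sqrt (n : ℝ))) ≤
      Real.exp (-(vkUpperConst / 4 * Real.sqrt (n : ℝ))) := by
    apply Real.exp_le_exp.2
    nlinarith
  have hF : (0 : ℝ) ≤ (n.factorial : ℝ) ^ ((3 : ℝ) / 2) := by positivity
  have hle := mul_le_mul_of_nonneg_left hexp hF
  linarith

end Summit.MatrixMultiplication.MatrixMultiplication.Theorems.HyperoctahedralThreshold.Negative
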